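import Summits.NavierStokesRegularity.NavierStokesRegularity.Theorems.ScaledTopAlignmentTypeIZoomNonAlignedLimitZoom
import Summits.NavierStokesRegularity.NavierStokesRegularity.Theorems.ClockStretchingLawClockCeilingUnidirectionalVorticityLiouville
import Summits.NavierStokesRegularity.NavierStokesRegularity.Theses.ScaledTopAlignment
import Literature.Analysis.FluidPDE.VorticityCalculus
import HarnessLib

/-!
# Route `ScaledTopAlignment`, crux GAP″ = `TypeIZoomNonAlignedLimit` (stmt-NavierStokesRegularity-19902)
# — PROVED: at a Type-I blow-up some vorticity zoom with moving centres converges pointwise to a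
# continuous field that is neither zero nor globally parallel (sign-blind) to one fixed vector

The crux (p3, ROUND-2/3 of cell ns-regularity-ideate; print level: Giga–Miura 2011, Prop. 2.1–2.2 and
§2.1 / Lemma 2.3 / Cor. 2.4, with Koch–Nadirashvili–Seregin–Šverák 2009) is assembled from two halves,
both over the tree's Type-I ancient mild class `IsTypeIAncientMild` (KNSS/Oseen gauge):

* **Z** (`typeIZoom_ancientMild_limit`, `ScaledTopAlignmentTypeIZoomNonAlignedLimitZoom.lean`): a
  classical Leray–Hopf solution with slab `L^∞` bounds, the Type-I rate at `T` and no smooth extension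
  past `T` has a zoom limit `W ∈ A_C` with `W(−1, 0) ≠ 0` (Leray's rate) whose slice vorticities are
  pointwise limits of parabolic vorticity zooms `(λ_j²/ν) ω(t_j, x_j + λ_j ·)` with moving centres;
* **U** (`ancientMild_sliceAlignedVorticity_trivial`, this file = p3's `stub_unidirectionalProfileTrivial`
  over `A_C`): an element of `A_C` each of whose slice vorticities is identically zero or everywhere
  sign-blind parallel to one (slice-dependent) non-zero vector vanishes identically — equality in
  Cauchy–Schwarz makes the slice vorticity parallel to a line, and the tree's Giga–Miura Liouville
  theorem `unidirectionalVorticityLiouville` (slice invariance along the vorticity line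
  `stub_sliceInvariantOfCurlParallel`, forward propagation of translation invariance
  `stub_translationInvariantAfter`, far-past stabilisation of the invariance subspaces, and the planar
  Type-I Liouville theorem KNSS 2009 Thm 5.1 / Remark 6.1 `KNSS2009_typeI_rate_liouville_holds`)
  concludes; the SIGN of the vorticity along the line is never used;

and the bookkeeping `scaledTopAlignment_typeIZoomNonAlignedLimit_proof : TypeIZoomNonAlignedLimit`:
if no zoom had a non-zero non-aligned limit, every slice vorticity of `W` would be zero-or-aligned,
so `W ≡ 0` by U, contradicting `W(−1, 0) ≠ 0`.

Relative to p3's skeleton `GapSkeleton2.lean` (item evidence 2026-08-25T20:56Z) the interface class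
`NsregP3.GapLine2.IsOseenTypeIProfile` is replaced by `IsTypeIAncientMild C` + non-triviality: its
extra clause "`V` bounded on all of `(−∞, 0) × ℝ³`" is not inherited by Type-I zoom limits (their
bound `C/√(−t)` degenerates at the blow-up time) and is not needed by U.

## References

* Y. Giga, H. Miura, Commun. Math. Phys. 303 (2011) 289–300, Thm 1.1, Prop. 2.1–2.2, §2.1,
  Lemma 2.3, Cor. 2.4. [GigaMiura2011]
* G. Koch, N. Nadirashvili, G. Seregin, V. Šverák, Acta Math. 203 (2009) 83–105, Thm 5.1,
  Remark 6.1, §6 (arXiv:0709.3599). [KochNadirashviliSereginSverak2009]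
* J. Leray, Acta Math. 63 (1934), §19 (3.9). [Leray1934]
-/

noncomputable section

-- the summit and its single sub-problem share the name (CONVENTIONS §1), as in every Theorems file
set_option linter.dupNamespace false

open Set Function Filter Topology
open scoped RealInnerProductSpace

namespace Summit.NavierStokesRegularity.NavierStokesRegularity.Theorems

open Literature.Analysis Literature.Analysis.FluidPDE

/-! ### Equality in Cauchy–Schwarz: sign-blind alignment is parallelism to a line -/

/-- **Equality in the Cauchy–Schwarz inequality**: if `e ≠ 0` and `⟪a, e⟫² = ‖a‖² ‖e‖²` then
`a = r e` with `r = ⟪a, e⟫/‖e‖²` (expand `‖a − r e‖² = ‖a‖² − ⟪a, e⟫²/‖e‖² = 0`). [folklore] -/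
theorem exists_smul_of_inner_sq_eq {a e : EuclideanSpace ℝ (Fin 3)} (he : e ≠ 0)
    (h : ⟪a, e⟫ ^ 2 = ‖a‖ ^ 2 * ‖e‖ ^ 2) : ∃ r : ℝ, a = r • e := by
  refine ⟨⟪a, e⟫ / ‖e‖ ^ 2, ?_⟩
  have he2 : ‖e‖ ^ 2 ≠ 0 := pow_ne_zero 2 (norm_ne_zero_iff.2 he)
  have h0 : ‖a - (⟪a, e⟫ / ‖e‖ ^ 2) • e‖ ^ 2 = 0 := by
    rw [norm_sub_sq_real, inner_smul_right, norm_smul, mul_pow, Real.norm_eq_abs, sq_abs]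
    field_simp
    linear_combination (-1 : ℝ) * h
  rw [sq_eq_zero_iff, norm_eq_zero, sub_eq_zero] at h0
  exact h0

/-- A slice whose vorticity is identically zero, or everywhere sign-blind aligned with one non-zero
vector `e` (`⟪ω, e⟫² = ‖ω‖²‖e‖²`), has vorticity everywhere parallel to ONE non-zero vector. [folklore] -/
theorem exists_parallel_of_zero_or_signBlindAligned
    {ω : EuclideanSpace ℝ (Fin 3) → EuclideanSpace ℝ (Fin 3)}
    (h : (∀ y, ω y = 0) ∨ ∃ e : EuclideanSpace ℝ (Fin 3), e ≠ 0 ∧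
      ∀ y, ⟪ω y, e⟫ ^ 2 = ‖ω y‖ ^ 2 * ‖e‖ ^ 2) :
    ∃ e : EuclideanSpace ℝ (Fin 3), e ≠ 0 ∧ ∀ y, ∃ a : ℝ, ω y = a • e := by
  rcases h with h0 | ⟨e, he, hal⟩
  · refine ⟨EuclideanSpace.single 0 1, fun h1 => ?_, fun y => ⟨0, by rw [h0 y, zero_smul]⟩⟩
    have := congr_arg (fun v : EuclideanSpace ℝ (Fin 3) => v 0) h1
    simp at this
  · exact ⟨e, he, fun y => exists_smul_of_inner_sq_eq he (hal y)⟩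

/-! ### U — rigidity: slice-wise zero-or-aligned vorticity kills a Type-I ancient mild field -/

/-- **U (p3's `stub_unidirectionalProfileTrivial`, over the tree class `A_C`).** A Type-I ancient
mild field `V` (`IsTypeIAncientMild C V`) each of whose slice vorticities `curl V(s)`, `s < 0`, is
identically zero or everywhere sign-blind parallel to one non-zero vector `e(s)`
(`⟪curl V(s) y, e(s)⟫² = ‖curl V(s) y‖²‖e(s)‖²` for all `y`) vanishes identically on `t < 0`:
equality in Cauchy–Schwarz gives `curl V(s) ∥ e(s)`, and Giga–Miura's Liouville theorem for the
Type-I class (`unidirectionalVorticityLiouville`: §2.1 two-dimensional reduction slice by slice,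
forward propagation of translation invariance, far-past stabilisation, KNSS 2009 Thm 5.1 /
Remark 6.1) gives `V ≡ 0`. The sign of the vorticity along the line is never used. [cite: GigaMiura2011, §2.1 with Lemma 2.3 / Cor. 2.4 (Commun. Math. Phys. 303 (2011) 289–300)] -/
theorem ancientMild_sliceAlignedVorticity_trivial {C : ℝ}
    {V : ℝ → EuclideanSpace ℝ (Fin 3) → EuclideanSpace ℝ (Fin 3)} (hV : IsTypeIAncientMild C V)
    (hal : ∀ s < (0 : ℝ), (∀ y, curl (V s) y = 0) ∨
      ∃ e : EuclideanSpace ℝ (Fin 3), e ≠ 0 ∧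
        ∀ y, ⟪curl (V s) y, e⟫ ^ 2 = ‖curl (V s) y‖ ^ 2 * ‖e‖ ^ 2) :
    ∀ t < 0, ∀ x, V t x = 0 :=
  unidirectionalVorticityLiouville hV fun s hs => exists_parallel_of_zero_or_signBlindAligned (hal s hs)

/-! ### GAP″ -/

/-- **Crux `TypeIZoomNonAlignedLimit` (GAP″, stmt-NavierStokesRegularity-19902) holds.** For `ν > 0`,
`T > 0`, a classical solution `(u, p)` of the unforced Navier–Stokes system on `ℝ³ × [0, T)`,
Leray–Hopf from `u 0`, bounded on every `[0, T'] × ℝ³` (`T' < T`), with the Type-I rate at `T`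
(`IsTypeIBlowup u T`) and no smooth extension past `T`, there are centres `x_j`, times `t_j ∈ [0,T)`,
scales `λ_j → 0⁺` and a continuous `Ω` with `(λ_j²/ν) curl u(t_j)(x_j + λ_j y) → Ω(y)` for every
`y`, `Ω ≢ 0`, and `Ω` NOT sign-blind parallel to any fixed non-zero vector on all of `ℝ³`. Proof:
Z (`typeIZoom_ancientMild_limit`) gives a non-trivial Type-I ancient mild zoom limit `W` all of whose
slice vorticities are such zoom limits (and continuous, `continuous_curl`); were every one of them
zero-or-aligned, U (`ancientMild_sliceAlignedVorticity_trivial`) would force `W ≡ 0`, contradicting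
`W(−1, 0) ≠ 0`. [cite: GigaMiura2011, Thm 1.1 with Prop. 2.1–2.2 and §2.1 (Commun. Math. Phys. 303 (2011) 289–300)] -/
theorem scaledTopAlignment_typeIZoomNonAlignedLimit_proof :
    Summit.NavierStokesRegularity.NavierStokesRegularity.Theses.ScaledTopAlignment.TypeIZoomNonAlignedLimit := by
  intro ν T hν hT u p hsol hLH hslab hI hext
  obtain ⟨C, W, hW, hW0, hzoom⟩ := typeIZoom_ancientMild_limit hν hT hsol hLH hslab hI hext
  by_contra H
  have hal : ∀ s < (0 : ℝ), (∀ y, curl (W s) y = 0) ∨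
      ∃ e : EuclideanSpace ℝ (Fin 3), e ≠ 0 ∧
        ∀ y, ⟪curl (W s) y, e⟫ ^ 2 = ‖curl (W s) y‖ ^ 2 * ‖e‖ ^ 2 := by
    intro s hs
    obtain ⟨xc, t, lam, ht, hlam, hlam0, hconv⟩ := hzoom s hs
    have hcont : Continuous (curl (W s)) :=
      continuous_curl ((hW.contDiff_slice hs).of_le (by exact_mod_cast le_top))
    by_contra hne
    obtain ⟨hA, hB⟩ := not_or.mp hne
    exact H ⟨xc, t, lam, curl (W s), ht, hlam, hlam0, hcont, hconv, hA, hB⟩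
  exact hW0 (ancientMild_sliceAlignedVorticity_trivial hW hal (-1) (by norm_num) 0)

end Summit.NavierStokesRegularity.NavierStokesRegularity.Theorems

end
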